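import Summits.Ventures.MM22.Rank333.ProfileCertSigma
import HarnessLib

/-!
# MM22 venture — PROFILE-CERT kernel replay: what the S-node header check establishes

HONEST FRAMING (cell `pub-mm22`, seat p1 g5; V4-MENU item (0′) «kernel replay of the whole-root PROFILE-CERT»).
Checker PLUMBING with soundness theorems, written from the FROZEN format specification
`HOME/pub-mm22-p2/pcert/PROFILE-CERT-v1-frozen-20260822T2120Z.md` (sha256 59fc6c87…) only. The end declaration of the
chain (`ProfileCertGlue.rankGe21F2_of_pieces`) is an IMPLICATION whose antecedents are Wang's `Cert 3 3 3 [] 20`, a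
certified orbit table (Wang's printed values and the cell's 8 LP/LPDFS lifts), a passing singleton check and the
`NoExt` statement that the (not yet landed) data files assemble to. NOTHING here proves a bound on `R_𝔽₂(⟨3,3,3⟩)`;
no summit claim.

This file: `mapsInto`/BFS/`orbitsOK` specifications, OUT-stability, and `header_facts`.
-/

set_option autoImplicit false

namespace Summit.Ventures.MM22.ProfileCert

section Header0
open Finset
variable {rt : RT} {N : ℕ} {V : Finset ℕ → Prop}
/-! ### header extraction lemmas -/

section Header

/-- What `mapsInto` certifies. -/
theorem mapsInto_spec {σ : ℕ → ℕ} {m : ℕ} : ∀ {n : ℕ}, mapsInto σ m n = true →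
    ∀ f, 1 ≤ f → f ≤ n → m.testBit f = true → m.testBit (σ f) = true
  | 0, _, f, h1, h2, _ => by omega
  | n + 1, h, f, h1, h2, hm => by
    rw [mapsInto, Bool.and_eq_true] at h
    by_cases hf : f = n + 1
    · subst hf
      rw [hm] at h
      simpa using h.2
    · exact mapsInto_spec h.1 f h1 (by omega) hm

/-- BFS round: everything recorded is reachable. -/
theorem bfsRound_reach (σs : List (ℕ → ℕ)) (x₀ : ℕ) :
    ∀ (fr : List ℕ) (vis : ℕ) (acc : List ℕ),
      (∀ y, vis.testBit y = true → Reach σs x₀ y) → (∀ y ∈ fr, Reach σs x₀ y) → (∀ y ∈ acc, Reach σs x₀ y) →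
      (∀ y, (bfsRound σs fr vis acc).1.testBit y = true → Reach σs x₀ y) ∧
      (∀ y ∈ (bfsRound σs fr vis acc).2, Reach σs x₀ y)
  | [], vis, acc, hv, _, ha => by rw [bfsRound]; exact ⟨hv, ha⟩
  | x :: xs, vis, acc, hv, hf, ha => by
    rw [bfsRound]
    have hx : Reach σs x₀ x := hf x (by simp)
    -- the inner fold keeps the invariant
    have inner : ∀ (l : List (ℕ → ℕ)), (∀ σ ∈ l, σ ∈ σs) → ∀ (va : ℕ × List ℕ),
        (∀ y, va.1.testBit y = true → Reach σs x₀ y) → (∀ y ∈ va.2, Reach σs x₀ y) →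
        (∀ y, (l.foldl (fun (va : ℕ × List ℕ) σ =>
            let y := σ x
            if va.1.testBit y then va else (va.1 ||| 2 ^ y, y :: va.2)) va).1.testBit y = true → Reach σs x₀ y) ∧
        (∀ y ∈ (l.foldl (fun (va : ℕ × List ℕ) σ =>
            let y := σ x
            if va.1.testBit y then va else (va.1 ||| 2 ^ y, y :: va.2)) va).2, Reach σs x₀ y) := by
      intro l
      induction l with
      | nil => intro _ va h1 h2; exact ⟨h1, h2⟩
      | cons σ l ih =>
        intro hl va h1 h2
        rw [List.foldl_cons]
        have hσx : Reach σs x₀ (σ x) := Relation.ReflTransGen.tail hx ⟨σ, hl σ (by simp), rfl⟩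
        apply ih (fun τ hτ => hl τ (List.mem_cons_of_mem σ hτ))
        · intro y hy
          simp only at hy
          split at hy
          · exact h1 y hy
          · simp only [Nat.testBit_or, Bool.or_eq_true, Nat.testBit_two_pow, decide_eq_true_eq] at hy
            rcases hy with hy | rfl
            · exact h1 y hy
            · exact hσx
        · intro y hy
          simp only at hy
          split at hy
          · exact h2 y hy
          · rcases List.mem_cons.1 hy with rfl | hy
            · exact hσx
            · exact h2 y hy
    obtain ⟨i1, i2⟩ := inner σs (fun σ h => h) (vis, acc) hv ha
    exact bfsRound_reach σs x₀ xs _ _ i1 (fun y hy => hf y (List.mem_cons_of_mem x hy)) i2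

/-- Everything the BFS visits is reachable. -/
theorem bfs_reach (σs : List (ℕ → ℕ)) (x₀ : ℕ) : ∀ (n : ℕ) (vis : ℕ) (fr : List ℕ),
    (∀ y, vis.testBit y = true → Reach σs x₀ y) → (∀ y ∈ fr, Reach σs x₀ y) →
    ∀ y, (bfs σs n vis fr).testBit y = true → Reach σs x₀ y
  | 0, vis, fr, hv, _ => by simp only [bfs]; exact hv
  | n + 1, vis, [], hv, _ => by simp only [bfs]; exact hv
  | n + 1, vis, x :: xs, hv, hf => by
    simp only [bfs]
    obtain ⟨h1, h2⟩ := bfsRound_reach σs x₀ (x :: xs) vis [] hv hf (by simp)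
    exact bfs_reach σs x₀ n _ _ h1 h2

/-- A list no longer than its set of entries has no duplicates. -/
theorem nodup_of_card_eq {l : List ℕ} (h : l.length ≤ l.toFinset.card) : l.Nodup := by
  have := List.toFinset_card_le (l := l)
  have heq : (l : Multiset ℕ).toFinset.card = Multiset.card (l : Multiset ℕ) := by
    rw [Multiset.coe_card]; exact le_antisymm this h
  exact Multiset.coe_nodup.1 (Multiset.toFinset_card_eq_card_iff_nodup.1 heq)

/-- What `orbitsOK` establishes. -/
theorem orbitsOK_spec (σs : List (ℕ → ℕ)) : ∀ (orbits : List (List ℕ)) (acc u : ℕ),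
    orbitsOK σs orbits acc = some u →
      (∀ o ∈ orbits, o.Nodup ∧ (∀ f ∈ o, f ∈ forms) ∧ (∀ σ ∈ σs, ∀ f ∈ o, σ f ∈ o) ∧
          (∀ m ∈ o, ∃ x₀, o.head? = some x₀ ∧ Reach σs x₀ m) ∧ (∀ f ∈ o, acc.testBit f = false)) ∧
      orbits.Pairwise (fun o o' => ∀ f ∈ o, f ∉ o') ∧
      (∀ f, u.testBit f = true ↔ acc.testBit f = true ∨ ∃ o ∈ orbits, f ∈ o)
  | [], acc, u, h => by
    simp only [orbitsOK, Option.some.injEq] at h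
    subst h; simp
  | o :: os, acc, u, h => by
    cases o with
    | nil => simp [orbitsOK] at h
    | cons x₀ xs =>
      simp only [orbitsOK] at h
      split at h
      · rename_i hc
        simp only [Bool.and_eq_true, Bool.not_eq_true', decide_eq_true_eq, List.all_eq_true, beq_iff_eq] at hc
        obtain ⟨⟨⟨⟨hdis, h0⟩, hlen⟩, hclo⟩, hbfs⟩ := hc
        set o := x₀ :: xs with ho
        have hm : ∀ f, (maskOf o).testBit f = true ↔ f ∈ o := fun f => (mem_iff_testBit_maskOf o f).symm
        -- no overlap with acc
        have hacc : ∀ f ∈ o, acc.testBit f = false := by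
          intro f hf
          have := congrArg (fun z => z.testBit f) hdis
          simp only [Nat.testBit_and, Nat.zero_testBit, (hm f).2 hf, Bool.and_true] at this
          exact this
        -- nodup and ⊆ forms from the length count
        have hcount : o.length = (forms.filter fun f => f ∈ o).card := by
          have hset : (forms.filter fun f => (maskOf o).testBit f = true) = forms.filter fun f => f ∈ o := by
            ext f; simp only [Finset.mem_filter, hm]
          rw [hlen, countUpTo_NF, hset]
        have hsub1 : (forms.filter fun f => f ∈ o) ⊆ o.toFinset := fun f hf =>
          List.mem_toFinset.2 (Finset.mem_filter.1 hf).2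
        have hnd : o.Nodup := nodup_of_card_eq (by rw [hcount]; exact Finset.card_le_card hsub1)
        have hforms : ∀ f ∈ o, f ∈ forms := by
          intro f hf
          by_contra hff
          have hss : (forms.filter fun f => f ∈ o) ⊂ o.toFinset :=
            Finset.ssubset_iff_subset_ne.2 ⟨hsub1, fun he => hff (Finset.mem_filter.1 (he ▸ List.mem_toFinset.2 hf)).1⟩
          have := Finset.card_lt_card hss
          rw [← hcount] at this
          exact absurd (List.toFinset_card_le (l := o)) (not_le.2 this)
        -- closure
        have hclosed : ∀ σ ∈ σs, ∀ f ∈ o, σ f ∈ o := fun σ hσ f hf =>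
          (hm _).1 (mapsInto_spec (hclo σ hσ) f (mem_forms.1 (hforms f hf)).1 (mem_forms.1 (hforms f hf)).2
            ((hm f).2 hf))
        -- reachability
        have hreach : ∀ m ∈ o, ∃ y, o.head? = some y ∧ Reach σs y m := by
          intro m hmo
          refine ⟨x₀, rfl, ?_⟩
          have := bfs_reach σs x₀ (o.length + 1) (2 ^ x₀) [x₀]
            (fun y hy => by
              rw [Nat.testBit_two_pow, decide_eq_true_eq] at hy
              subst hy; exact Relation.ReflTransGen.refl)
            (fun y hy => by simp at hy; subst hy; exact Relation.ReflTransGen.refl) m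
          rw [hbfs] at this
          exact this ((hm m).2 hmo)
        -- recurse
        obtain ⟨ih1, ih2, ih3⟩ := orbitsOK_spec σs os (acc ||| maskOf o) u h
        refine ⟨fun o' ho' => ?_, List.pairwise_cons.2 ⟨fun o' ho' f hf hf' => ?_, ih2⟩, fun f => ?_⟩
        · rcases List.mem_cons.1 ho' with rfl | ho'
          · exact ⟨hnd, hforms, hclosed, hreach, hacc⟩
          · obtain ⟨a1, a2, a3, a4, a5⟩ := ih1 o' ho'
            refine ⟨a1, a2, a3, a4, fun f hf => ?_⟩
            have := a5 f hf
            rw [Nat.testBit_or, Bool.or_eq_false_iff] at this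
            exact this.1
          -- pairwise: f ∈ o, f ∈ o' ∈ os impossible
        · have := (ih1 o' ho').2.2.2.2 f hf'
          rw [Nat.testBit_or, Bool.or_eq_false_iff] at this
          rw [(hm f).2 hf] at this
          exact Bool.noConfusion this.2
        · rw [ih3 f, Nat.testBit_or, Bool.or_eq_true]
          constructor
          · rintro ((h | h) | ⟨o', ho', hf⟩)
            · exact Or.inl h
            · exact Or.inr ⟨o, List.mem_cons_self, (hm f).1 h⟩
            · exact Or.inr ⟨o', List.mem_cons_of_mem _ ho', hf⟩
          · rintro (h | ⟨o', ho', hf⟩)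
            · exact Or.inl (Or.inl h)
            · rcases List.mem_cons.1 ho' with rfl | ho'
              · exact Or.inl (Or.inr ((hm f).2 hf))
              · exact Or.inr ⟨o', ho', hf⟩
      · simp at h


/-- OUT is preserved once the forms are permuted, IN is preserved and FREE (a union of closed orbits) is preserved. -/
theorem out_preserved {s : St} (hW : s.WF) {σ : ℕ → ℕ} (hb : Set.BijOn σ (↑forms) (↑forms))
    (hin : ∀ f ∈ s.inL, σ f ∈ s.inL) (hfree : ∀ f, s.free f = true → s.free (σ f) = true) :
    ∀ f ∈ forms, s.out.testBit f = true → s.out.testBit (σ f) = true := by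
  classical
  intro f hf ho
  -- the complement of OUT inside the forms
  let C : Finset ℕ := forms.filter fun g => s.out.testBit g = false
  have hC : ∀ g, g ∈ C ↔ g ∈ forms ∧ s.out.testBit g = false := fun g => by simp [C]
  have hmaps : Set.MapsTo σ (↑C) (↑C) := by
    intro g hg
    rw [Finset.mem_coe, hC] at hg ⊢
    refine ⟨hb.mapsTo hg.1, ?_⟩
    by_cases hgi : g ∈ s.inL
    · exact hW.in_out _ (hin g hgi)
    · have hgf : s.free g = true := St.free_spec.2 ⟨hg.1, hgi, hg.2⟩
      exact (St.free_spec.1 (hfree g hgf)).2.2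
  have hinj : Set.InjOn σ (↑C) := hb.injOn.mono fun g hg => by
    rw [Finset.mem_coe, hC] at hg; exact Finset.mem_coe.2 hg.1
  have hsurj : Set.SurjOn σ (↑C) (↑C) := Finset.surjOn_of_injOn_of_card_le σ hmaps hinj le_rfl
  cases hσ : s.out.testBit (σ f)
  · exfalso
    have hσC : σ f ∈ C := (hC _).2 ⟨hb.mapsTo hf, hσ⟩
    obtain ⟨g, hg, hgf⟩ := hsurj (Finset.mem_coe.2 hσC)
    rw [Finset.mem_coe, hC] at hg
    have : g = f := hb.injOn (Finset.mem_coe.2 hg.1) (Finset.mem_coe.2 hf) hgf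
    subst this
    rw [hg.2] at ho
    exact Bool.noConfusion ho
  · rfl

/-- Header extraction: the Boolean header check yields the map facts and the orbit facts. -/
theorem header_facts {maps : List MapW} (hsym : SymOKL V maps) {s : St} (hW : s.WF)
    {orbits : List (List ℕ)} (h : sHeaderOK maps orbits s = true) :
    SigFacts V (sigmas maps) s ∧ OrbFacts (sigmas maps) s orbits := by
  unfold sHeaderOK at h
  simp only [Bool.and_eq_true] at h
  obtain ⟨hmaps, horb⟩ := h
  rw [List.all_eq_true] at hmaps
  -- orbit facts first
  have hof : OrbFacts (sigmas maps) s orbits := by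
    split at horb
    · exact Bool.noConfusion horb
    · rename_i u hu
      rw [decide_eq_true_eq] at horb
      obtain ⟨h1, h2, h3⟩ := orbitsOK_spec (sigmas maps) orbits 0 u hu
      rw [horb] at h3
      refine ⟨fun o ho f hf => ?_, fun o ho => (h1 o ho).1, h2, fun f hf => ?_, fun σ hσ o ho => (h1 o ho).2.2.1 σ hσ,
        fun o ho => (h1 o ho).2.2.2.1⟩
      · exact St.free_iff.2 ((St.testBit_freeMask hW f).1 ((h3 f).2 (Or.inr ⟨o, ho, hf⟩)))
      · have := (h3 f).1 ((St.testBit_freeMask hW f).2 (St.free_iff.1 hf))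
        rw [Nat.zero_testBit] at this
        rcases this with h | h
        · exact Bool.noConfusion h
        · exact h
  refine ⟨fun σ hσ => ?_, hof⟩
  obtain ⟨mp, hmp, rfl⟩ := List.mem_map.1 hσ
  have hc := hmaps mp hmp
  simp only [Bool.and_eq_true, List.all_eq_true] at hc
  obtain ⟨hinv, hin⟩ := hc
  have hin' : ∀ f ∈ s.inL, mp.sigma f ∈ s.inL := fun f hf => by
    have := hin f hf
    rwa [List.elem_eq_mem, decide_eq_true_eq] at this
  have hb := bijOn_of_invOK hinv
  have hfree : ∀ f, s.free f = true → s.free (mp.sigma f) = true := by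
    intro f hf
    obtain ⟨o, ho, hfo⟩ := hof.cover f hf
    exact hof.free o ho _ (hof.closed _ hσ o ho f hfo)
  exact ⟨hb, hin', out_preserved hW hb hin' hfree, hsym mp hmp hinv⟩

end Header


end Header0

end Summit.Ventures.MM22.ProfileCert
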